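import Summits.CriticalPhenomena.PercolationContinuityZ3.Theorems.FK.InfiniteVolumeDLR
import Literature.Probability.LatticeModels.RandomClusterClosedCut
import HarnessLib

/-!
# FK-continuity cell, FO-10a: the FREE domain Markov property across a closed edge boundary, for the
# box laws and for the infinite-volume limits `φ⁰_{p,q}`, `φ¹_{p,q}` on `ℤ^d`

Registered R73 (cell INBOX l.5522, 2026-08-23); registry row FO-10a-g335; label NPC-A (coordinator fk-4 g152).
Cell `fk-continuity` (bschramm), row FO-10a (domain-Markov + comparison layer over FO-06); support file
for the FK-continuity transplant (`--supports stmt-CriticalPhenomena-4575`); builds on p205010 (kernel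
theorem, internal audit signed; external expert review pending). Pure proofs; no definitions, no named
facts, no sorries. General dimension `d`, both boundary conditions `b`, `0 ≤ p ≤ 1`, `q > 0`.

Grimmett 2006, Lemma (4.13) (p. 71) with Thm. (3.1)(a): conditionally on the configuration OFF the edge
set `E_Λ` of a finite region `Λ`, the configuration on `E_Λ` is the random-cluster measure of `Λ` with
the boundary condition induced by the outside connections. The cell's interface `FKGibbs`
(`InfiniteVolumeGibbs.lean`) records the two EXTREME cases as a sandwich
`φ⁰_Λ(A) P(H) ≤ P(A ∩ H) ≤ φ¹_Λ(A) P(H)`. This file adds the EXACT free case: if the outside event `H`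
forces every lattice edge with exactly one endpoint in `Λ` to be closed (a closed edge boundary; then
no two vertices of `Λ` are joined outside `E_Λ`, the induced boundary condition is FREE), then

  `P(A ∩ H) = φ⁰_{Λ,p,q}(A) · P(H)`

for EVERY `E_Λ`-local event `A` (no monotonicity needed) — first for the box laws `φ^b_{Λ_n,p,q}`
(`rcBoxMeasure_real_preimage_inter_eq_regionFreeReal_mul`, from the Literature's closed-cut Markov
property `rcMeasure_real_inter_eq_mul_fromEdgeSet_of_closed_cut` and the free transport
`rcMeasure_fromEdgeSet_insideEdges_empty_real` of FO-06a), then in the limit `Λ_n ↑ ℤ^d` for every box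
limit (`IsBoxLimit.real_inter_eq_regionFreeReal_mul_of_closed`, Grimmett's (4.20)), with the one-sided
form `IsBoxLimit.real_inter_le_of_closed` (`P(A ∩ H) ≤ P'(A) · P(H)` for any `FKGibbs` measure `P'` and
increasing `A`, by (4.21)/(4.24)) that drives the uniqueness theorem of
`UniquenessOfNonPercolation.lean` (Grimmett 2006, Thm. (5.33)(a) for `θ¹ = 0`;
Aizenman–Chayes–Chayes–Newman 1988, Thm. A.2). Two generic walk lemmas (reachability from a set closed under
the steps of a graph) used there are parked here as well.

## References

* G. Grimmett, *The Random-Cluster Model*, Springer 2006 (`book:grimmett2006-random-cluster-model`):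
  Thm. (3.1)(a); §4.2 (4.11)–(4.13), Lemma (4.13) [PDF p. 71]; Thm. (4.19)(a) (4.20), (c) (4.21), proof
  of (a) eq. (4.24) [PDF pp. 75–78]. [Grimmett2006]
-/

noncomputable section

open MeasureTheory Set Filter
open scoped Topology ENNReal

namespace Summit.CriticalPhenomena.PercolationContinuityZ3.Theorems.FK

open Literature.Probability.Percolation Literature.Probability.LatticeModels

/-! ## Two walk lemmas -/

section Walks

variable {V : Type*}

/-- A set closed under the steps of a graph contains everything reachable from it. [folklore] -/
theorem mem_of_reachable_of_forall_adj_mem {H : SimpleGraph V} {r : Set V}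
    (hr : ∀ ⦃a b : V⦄, a ∈ r → H.Adj a b → b ∈ r) {u v : V} (hu : u ∈ r) (h : H.Reachable u v) : v ∈ r := by
  obtain ⟨w⟩ := h
  induction w with
  | nil => exact hu
  | cons hab _ ih => exact ih (hr hu hab)

/-- Transfer of reachability: if `r` is closed under the steps of `H₁` and every step of `H₁` out of a vertex
of `r` is a step of `H₂`, then `H₁`-reachability from `r` implies `H₂`-reachability. [folklore] -/
theorem reachable_of_walk_of_forall_adj {H₁ H₂ : SimpleGraph V} {r : Set V}
    (hr : ∀ ⦃a b : V⦄, a ∈ r → H₁.Adj a b → b ∈ r) (ht : ∀ ⦃a b : V⦄, a ∈ r → H₁.Adj a b → H₂.Adj a b)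
    {u v : V} (hu : u ∈ r) (w : H₁.Walk u v) : H₂.Reachable u v := by
  induction w with
  | nil => exact SimpleGraph.Reachable.refl _
  | cons hab _ ih => exact (ht hu hab).reachable.trans (ih (hr hu hab))

end Walks

/-! ## Geometry: a region inside a strictly larger box misses the box boundary -/

section Geometry

variable {d : ℕ}

/-- A point of `Λ_m` is not on the inner vertex boundary of a strictly larger box `Λ_n`, `m < n`.
(the Literature's `mem_box_succ_of_adj`: a neighbour of a point of `Λ_m` lies in `Λ_{m+1} ⊆ Λ_n`).
[cite: Grimmett2006, §4.2 (∂Λ)] -/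
theorem notMem_innerBoundary_box_of_mem_box {m n : ℕ} (hmn : m < n) {x : Site d} (hx : x ∈ box d m) :
    x ∉ innerBoundary (zdGraph d) (box d n) := by
  rw [mem_innerBoundary_iff]
  rintro ⟨-, y, hy, hxy⟩
  exact hy (box_mono d (by omega) (mem_box_succ_of_adj hxy hx))

/-- `E_Λ ⊆ E_g` for `Λ ⊆ g`. [folklore] -/
theorem edgesIn_subset_edgesIn_of_subset {Λ g : Finset (Site d)} (h : Λ ⊆ g) :
    (↑(edgesIn (zdGraph d) Λ) : Set (Sym2 (Site d))) ⊆ ↑(edgesIn (zdGraph d) g) := by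
  intro e he
  rw [Finset.mem_coe, mem_edgesIn_iff] at he ⊢
  exact ⟨he.1, fun x hx => h (he.2 x hx)⟩

end Geometry

/-! ## The box laws: exact free Markov property across a closed edge boundary -/

section BoxLaw

open Finset SimpleGraph

variable {d : ℕ}

/-- **Free domain Markov property for the box laws, across a closed edge boundary** (Grimmett 2006,
Lemma (4.13) with Thm. (3.1)(a), free case, read on `ℤ^d`): let `Λ ⊆ Λ_n` miss `∂Λ_n`, let `A` be
determined by `E_Λ`, and let `H` be determined by a finite pair set disjoint from `E_Λ` and such that on
`H` every lattice edge with exactly one endpoint in `Λ` is closed. Then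
`φ^b_{Λ_n,p,q}(A ∩ H) = φ⁰_{Λ,p,q}(A) · φ^b_{Λ_n,p,q}(H)` (`0 ≤ p ≤ 1`, `q > 0`, both `b`).
[cite: Grimmett2006, Lemma (4.13) and Thm. (3.1)(a)] -/
theorem rcBoxMeasure_real_preimage_inter_eq_regionFreeReal_mul {p q : ℝ} (hp : p ∈ Set.Icc (0 : ℝ) 1)
    (hq : 0 < q) (b : Bool) {n : ℕ} {Λ : Finset (Site d)} (hΛ : Λ ⊆ box d n)
    (hΛb : ∀ x ∈ Λ, x ∉ innerBoundary (zdGraph d) (box d n)) {A H : Set (BondConfig (Site d))}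
    (T : Finset (Sym2 (Site d))) (hAΛ : DeterminedBy A ↑(edgesIn (zdGraph d) Λ))
    (hT : Disjoint (↑T : Set (Sym2 (Site d))) ↑(edgesIn (zdGraph d) Λ)) (hH : DeterminedBy H ↑T)
    (hHc : ∀ ω ∈ H, ∀ x ∈ Λ, ∀ y ∉ Λ, (zdGraph d).Adj x y → s(x, y) ∉ ω) :
    (rcBoxMeasure d b p q n).real (liftEdges (box d n) ⁻¹' (A ∩ H)) =
      regionFreeReal d p q Λ A * (rcBoxMeasure d b p q n).real (liftEdges (box d n) ⁻¹' H) := by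
  classical
  set U := insideEdges (zdGraph d) hΛ with hU
  have hAU : ∀ ω, ω ∈ liftEdges (box d n) ⁻¹' A ↔ ω ∩ ↑U ∈ liftEdges (box d n) ⁻¹' A :=
    mem_preimage_liftEdges_iff_inter (fun e he =>
      Finset.mem_coe.2 ((mem_insideEdges_iff_map_val_mem_edgesIn hΛ e).2 he)) hAΛ
  have hS : ∀ ω, ω ∈ liftEdges (box d n) ⁻¹' H ↔
      ω ∩ (↑U : Set (Sym2 ↥(box d n)))ᶜ ∈ liftEdges (box d n) ⁻¹' H :=
    mem_preimage_liftEdges_iff_inter (fun e he heU =>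
      Set.disjoint_left.1 hT he ((mem_insideEdges_iff_map_val_mem_edgesIn hΛ e).1 heU)) hH
  -- the cut: the vertices of the box off `Λ`
  set S : Set ↥(box d n) := {v | v.1 ∉ Λ} with hSdef
  -- the inner edges of `Λ` have no endpoint in `S`
  have hUS : ∀ e ∈ U, ∀ x ∈ e, x ∉ S := by
    intro e he x hx hxS
    have he' := (mem_insideEdges_iff_map_val_mem_edgesIn hΛ e).1 he
    rw [mem_edgesIn_iff] at he'
    exact hxS (he'.2 x.1 (Sym2.mem_map.2 ⟨x, hx, rfl⟩))
  -- `H` read on the box is determined off `U`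
  have hF : ∀ ω₁ ω₂ : BondConfig ↥(box d n), ω₁ ∩ (↑U)ᶜ = ω₂ ∩ (↑U)ᶜ →
      (ω₁ ∈ liftEdges (box d n) ⁻¹' H ↔ ω₂ ∈ liftEdges (box d n) ⁻¹' H) := by
    intro ω₁ ω₂ h12
    rw [hS ω₁, hS ω₂, h12]
  -- on `H` the off-`U` configuration has all its edges inside `S` (the cut is closed)
  have hFS : ∀ ζ : Finset (Sym2 ↥(box d n)), ζ ⊆ (finsetGraph (zdGraph d) (box d n)).edgeFinset \ U →
      (↑ζ : BondConfig ↥(box d n)) ∈ liftEdges (box d n) ⁻¹' H → ∀ e ∈ ζ, ∀ x ∈ e, x ∈ S := by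
    intro ζ hζ hζH e he x hx
    by_contra hxS
    have hxΛ : x.1 ∈ Λ := by
      by_contra h
      exact hxS h
    have he' := Finset.mem_sdiff.1 (hζ he)
    -- the other endpoint of `e` lies off `Λ`
    have hnot : ¬ ∀ z ∈ Sym2.map Subtype.val e, z ∈ Λ := by
      intro hall
      apply he'.2
      rw [hU, mem_insideEdges_iff_map_val_mem_edgesIn hΛ e, mem_edgesIn_iff]
      refine ⟨?_, hall⟩
      have hE := he'.1
      revert hE
      induction e using Sym2.ind with
      | h a c =>
        intro hE
        rw [mem_edgeFinset, SimpleGraph.mem_edgeSet, finsetGraph_adj_iff] at hE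
        rw [Sym2.map_mk, SimpleGraph.mem_edgeSet]
        exact hE
    push Not at hnot
    obtain ⟨z, hz, hzΛ⟩ := hnot
    obtain ⟨y, hy, rfl⟩ := Sym2.mem_map.1 hz
    -- `e = s(x, y)` up to orientation, an edge of the box graph
    have hexy : e = s(x, y) := by
      have hne : x ≠ y := by
        rintro rfl
        exact hzΛ hxΛ
      exact (Sym2.mem_and_mem_iff hne).1 ⟨hx, hy⟩
    have hadj : (zdGraph d).Adj x.1 y.1 := by
      have hE := he'.1
      rw [hexy, mem_edgeFinset, SimpleGraph.mem_edgeSet, finsetGraph_adj_iff] at hE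
      exact hE
    -- the lattice edge `s(x, y)` is open in the lifted configuration, which lies in `H`
    have hopen : s(x.1, y.1) ∈ liftEdges (box d n) (↑ζ : BondConfig ↥(box d n)) :=
      mem_liftEdges_iff.2 ⟨e, Finset.mem_coe.2 he, by rw [hexy, Sym2.map_mk]⟩
    exact hHc _ hζH x.1 hxΛ y.1 hzΛ hadj hopen
  have key := rcMeasure_real_inter_eq_mul_fromEdgeSet_of_closed_cut (finsetGraph (zdGraph d) (box d n))
    hp hq (boxBC d b n) S U (insideEdges_subset_edgeFinset hΛ) hUS (liftEdges (box d n) ⁻¹' H) hF hFS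
    (liftEdges (box d n) ⁻¹' A)
  -- the event `{ω ∩ U ∈ A}` is `A` itself, read on the box
  have hAe : {ω : BondConfig ↥(box d n) | ω ∩ ↑U ∈ liftEdges (box d n) ⁻¹' A} = liftEdges (box d n) ⁻¹' A := by
    ext ω; exact (hAU ω).symm
  -- no wired vertex lies in `Λ`: the induced boundary condition of `Λ` is free
  have hBS : boxBC d b n \ S = ∅ := by
    ext v
    simp only [Set.mem_sdiff, Set.mem_empty_iff_false, iff_false, not_and, hSdef, Set.mem_setOf_eq,
      not_not]
    intro hv hvΛ
    cases b
    · simp [boxBC] at hv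
    · simp only [boxBC, cond_true, mem_wiredBoundary_iff] at hv
      exact hΛb v.1 hvΛ hv
  rw [hAe, hBS, rcMeasure_fromEdgeSet_insideEdges_empty_real hp hq hΛ A] at key
  rw [Set.preimage_inter]
  unfold rcBoxMeasure
  rw [key, mul_comm]
  rfl

end BoxLaw

/-! ## The limit measures: exact free Markov property across a closed edge boundary -/

section Limit

variable {d : ℕ} {b : Bool} {p q : ℝ} {P : Measure (BondConfig (Site d))}

/-- **Free domain Markov property of `φ^b_{p,q}` across a closed edge boundary** (Grimmett 2006,
Lemma (4.13) / Thm. (3.1)(a) in the limit (4.20)): if `P` is a box limit (`IsBoxLimit d b p q P`,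
`0 ≤ p ≤ 1`, `q > 0`), `Λ` a finite region, `A` determined by `E_Λ`, and `H` determined by a finite pair
set disjoint from `E_Λ` such that on `H` every lattice edge with exactly one endpoint in `Λ` is closed,
then `P(A ∩ H) = φ⁰_{Λ,p,q}(A) · P(H)`: given a closed edge boundary, the inside of `Λ` is FREE.
[cite: Grimmett2006, Lemma (4.13), Thm. (3.1)(a), Thm. (4.19)(a) (4.20)] -/
theorem IsBoxLimit.real_inter_eq_regionFreeReal_mul_of_closed (hP : IsBoxLimit d b p q P)
    (hp : p ∈ Set.Icc (0 : ℝ) 1) (hq : 0 < q) (Λ : Finset (Site d)) {A H : Set (BondConfig (Site d))}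
    (T : Finset (Sym2 (Site d))) (hAΛ : DeterminedBy A ↑(edgesIn (zdGraph d) Λ))
    (hT : Disjoint (↑T : Set (Sym2 (Site d))) ↑(edgesIn (zdGraph d) Λ)) (hH : DeterminedBy H ↑T)
    (hHc : ∀ ω ∈ H, ∀ x ∈ Λ, ∀ y ∉ Λ, (zdGraph d).Adj x y → s(x, y) ∉ ω) :
    P.real (A ∩ H) = regionFreeReal d p q Λ A * P.real H := by
  classical
  have hHl : IsLocalEvent H := ⟨T, hH⟩
  have hAl : IsLocalEvent A := ⟨_, hAΛ⟩
  refine tendsto_nhds_unique (hP.tendsto_rcBoxMeasure_real_preimage (hAl.inter hHl)) ?_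
  refine ((hP.tendsto_rcBoxMeasure_real_preimage hHl).const_mul _).congr' ?_
  rw [Filter.EventuallyEq, Filter.eventually_atTop]
  refine ⟨Λ.sup siteRad + 1, fun n hn => ?_⟩
  exact (rcBoxMeasure_real_preimage_inter_eq_regionFreeReal_mul hp hq b
    (subset_box_of_sup_siteRad_le (by omega))
    (fun x hx => notMem_innerBoundary_box_of_mem_box (by omega) (subset_box_of_sup_siteRad_le le_rfl hx))
    T hAΛ hT hH hHc).symm

/-- **One-sided form used for uniqueness**: under the hypotheses of
`IsBoxLimit.real_inter_eq_regionFreeReal_mul_of_closed` and for `A` moreover INCREASING, for every measure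
`P'` of the cell's sandwich class `FKGibbs d p q P'` (e.g. `P' = φ⁰_{p,q}`):
`P(A ∩ H) ≤ P'(A) · P(H)` — inside a closed edge boundary the configuration is free, and the free
measure of a finite region lies below every infinite-volume random-cluster measure on increasing events
(Grimmett 2006, (4.21)/(4.24)). [cite: Grimmett2006, Lemma (4.13), Thm. (4.19)(a) eq. (4.24), (c) eq. (4.21)] -/
theorem IsBoxLimit.real_inter_le_of_closed (hP : IsBoxLimit d b p q P) (hp : p ∈ Set.Icc (0 : ℝ) 1)
    (hq : 0 < q) {P' : Measure (BondConfig (Site d))} (hP' : FKGibbs d p q P') (Λ : Finset (Site d))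
    {A H : Set (BondConfig (Site d))} (T : Finset (Sym2 (Site d))) (hA : IsUpperSet A)
    (hAΛ : DeterminedBy A ↑(edgesIn (zdGraph d) Λ))
    (hT : Disjoint (↑T : Set (Sym2 (Site d))) ↑(edgesIn (zdGraph d) Λ)) (hH : DeterminedBy H ↑T)
    (hHc : ∀ ω ∈ H, ∀ x ∈ Λ, ∀ y ∉ Λ, (zdGraph d).Adj x y → s(x, y) ∉ ω) :
    P.real (A ∩ H) ≤ P'.real A * P.real H := by
  rw [hP.real_inter_eq_regionFreeReal_mul_of_closed hp hq Λ T hAΛ hT hH hHc]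
  exact mul_le_mul_of_nonneg_right (hP'.regionFreeReal_le Λ hA hAΛ) measureReal_nonneg

end Limit

end Summit.CriticalPhenomena.PercolationContinuityZ3.Theorems.FK

end
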